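import Summits.CriticalPhenomena.Ising3DConformalLimit.Theorems.EnergyNotSigmaSquaredMoebiusLimitExistsPinnedTwoPoint
import Summits.CriticalPhenomena.Ising3DConformalLimit.Theorems.EnergyNotSigmaSquaredMoebiusLimitExistsFreeClusterPointWick
import Summits.CriticalPhenomena.Ising3DConformalLimit.Theorems.EnergyNotSigmaSquaredMoebiusLimitExistsWickPowerMoebius
import Summits.CriticalPhenomena.Ising3DConformalLimit.Theorems.ExistsScaleCovariantLimit.Negative.TightnessUniqueness
import Summits.CriticalPhenomena.Ising3DConformalLimit.Theorems.MoebiusLimitExists.Negative.PinnedClusterPoints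
import Summits.CriticalPhenomena.Ising3DConformalLimit.Theorems.MoebiusLimitOfTwoPointLaw.Negative.TwoPointConvergence
import Summits.CriticalPhenomena.Ising3DConformalLimit.Theorems.HyperoctahedralRPHRP2Rigidity
import Summits.CriticalPhenomena.Ising3DConformalLimit.Theses.HyperoctahedralRP
import Summits.CriticalPhenomena.Ising3DConformalLimit.Theses.MonotoneRG
import Literature.Barriers.CriticalPhenomena.BootstrapLatticeBlindness
import HarnessLib

/-!
# Residue dictionary of the line `only-interaction-breaks-moebius`: the uniqueness residue 6′ IS the
existence crux `ExistsScaleCovariantLimit`, and the inversion residue 5′ is the Polyakov upgrade on the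
realised branch
(crux `MoebiusLimitExists`, item stmt-CriticalPhenomena-1344, route `EnergyNotSigmaSquared`; registered anchor
`existsScaleCovariantLimit_iff_residue6_cpt`; lead c2, 2026-08-16)

Throughout, the two-point law (the data of item stmt-0634: `⟨σ₀σ_y⟩_{β_c}‖y‖^{2Δ} → c > 0`) and the
CONCLUSION of STUB 1 of the line — sequential compactness of the pinned critical zoom with regular cluster
points (`pinnedZoom_compactness`, file `…PinnedZoomCompactness.lean`; here the hypothesis `hcpt`, so that
this file lands independently of the farm build of that module) — are hypotheses. (For the same reason the
two small inputs from `…ClusterPointLowOrders.lean` / `…UniformRegularity.lean` — low orders of cluster points are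
free; `OrbitPrecompact` from sequential compactness — are re-derived inline inside the proofs.) Results:

* `orbitPrecompact_of_cpt`: item stmt-5955 `MonotoneRG.OrbitPrecompact` (precompactness of the critical
  orbit, crux r4 of route `MonotoneRG`) FOLLOWS — with `ρ = ρ_pin` and non-degenerate (indeed pure-power)
  cluster points.
* `existsScaleCovariantLimit_iff_unique_cpt`: item stmt-1981 `ExistsScaleCovariantLimit` (existence of the
  full scaling limit without rotations, crux r4 of route `HyperoctahedralRP`) is EQUIVALENT to uniqueness of
  the cluster point of the pinned zoom (the refuter's `crux_iff_orbitPrecompact_and_unique` with its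
  tightness half discharged).
* `existsScaleCovariantLimit_iff_residue6_cpt` (registered anchor): item stmt-1981 is EQUIVALENT to the
  line's registered residue 6′ `stub_interactingUnique_ge_four` VERBATIM (uniqueness anchored at an
  interacting regular cluster point, at even orders `≥ 4`). `⇐`: if some regular cluster point is
  interacting, 6′ makes it the full pinned limit (`hasLimit_of_residue6_cpt`); otherwise every regular
  cluster point is the Wick power family and the pinned zoom converges to it (`pinnedLimit_of_allFree_cpt`);
  either way the pinned limit exists, which is the crux 1981 (`crux_of_pinnedLimit`). `⇒`: under 1981 all
  cluster points coincide (`PinnedClusterPoints.clusterPoint_eq`).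
* `residue5_of_upgrades_cpt`: GIVEN 6′, the line's other residue 5′ `stub_interactingInversion_ge_four`
  follows from the two covariance cruxes of route `HyperoctahedralRP` applied to the realised pinned limit:
  item stmt-1980 `LimitRotationInvariant` (whose hypothesis `HRP2Rigidity`, item stmt-1979, is the tree
  theorem `HRP2Rigidity_of`) and item stmt-1982 `InversionUpgradeNormalised` — scale covariance with the
  right `Δ` and translation invariance being free (`exists_scaleCovariant_normalised`,
  `delta_eq_of_clusterPoint`).

So, given item 0634, the crux `MoebiusLimitExists` of this line factors EXACTLY through the existing crux
items 1981 (existence = 6′) and 1980 + 1982 (covariance upgrades ⊇ 5′ on the realised branch); compactness,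
the free branch and every other clause are theorems. No definitions, no `sorry`.

References: H. Duminil-Copin, ICM 2022 §8.4 ("proving that these scaling limits indeed exist … widely
open"); A. M. Polyakov, JETP Lett. 12 (1970) (the inversion upgrade); the equivalences are elementary
topology of locally uniform convergence on top of the tree files cited inline. [folklore]
-/

noncomputable section

open Filter Topology Set Function Metric
open Literature.Probability.LatticeModels
open Literature.Barriers.CriticalPhenomena (hasPointwiseScalingLimit_of_seq_subseq)

namespace Summit.CriticalPhenomena.Ising3DConformalLimit.MoebiusLimitExistsOnlyInteraction

open Summit.CriticalPhenomena.Ising3DConformalLimit.Theses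
open Summit.CriticalPhenomena.Ising3DConformalLimit.MoebiusLimitExistsNegative
  (tendsto_div_succ_nhdsGT exists_scaleCovariant_normalised)
open Summit.CriticalPhenomena.Ising3DConformalLimit.ExistsScaleCovariantLimitNegative
  (crux_of_pinnedLimit crux_iff_orbitPrecompact_and_unique pinnedLimit_iff_tight_and_unique)
open Summit.CriticalPhenomena.Ising3DConformalLimit.PinnedClusterPoints (clusterPoint_eq delta_eq_of_clusterPoint)

/-! ### Item 5955 `OrbitPrecompact` from compactness of the pinned zoom -/

/-- **Item stmt-5955 `MonotoneRG.OrbitPrecompact` from the two-point law and compactness of the pinned zoom**: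
`ρ = ρ_pin`, and every cluster point has the pure-power pair function (`stub_pinnedTwoPoint`), hence is
non-degenerate. [folklore] -/
theorem orbitPrecompact_of_cpt {Δ c : ℝ} (hc : 0 < c)
    (hG : Tendsto (fun y : Site 3 => criticalTwoPoint 3 y * Real.sqrt (∑ i, ((y i : ℝ)) ^ 2) ^ (2 * Δ))
      cofinite (𝓝 c))
    (hcpt : ∀ u : ℕ → ℝ, Tendsto u atTop (𝓝[>] (0 : ℝ)) →
      ∃ (φ : ℕ → ℕ) (S : CorrFamily 3), StrictMono φ ∧ IsRegular S ∧
        ∀ n, TendstoLocallyUniformlyOn (fun k => rescaledCorrelator (criticalCorr 3) rhoPin n (u (φ k)))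
          (S n) atTop (NonCoincident 3 n)) :
    MonotoneRG.OrbitPrecompact := by
  refine ⟨rhoPin, rhoPin_pos, fun u hu01 hu0 => ?_⟩
  have hu : Tendsto u atTop (𝓝[>] (0 : ℝ)) :=
    tendsto_nhdsWithin_iff.2 ⟨hu0, Eventually.of_forall fun k => (hu01 k).1⟩
  obtain ⟨φ, S, hφ, _hreg, hconv⟩ := hcpt u hu
  exact ⟨φ, S, hφ, isNondegenerateTwoPoint_of_twoPoint
    (stub_pinnedTwoPoint Δ c hc hG S (isClusterPoint_of_subseq hu hφ hconv)), hconv⟩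

/-- **Item stmt-1981 `ExistsScaleCovariantLimit` ⟺ UNIQUENESS of the cluster point of the pinned zoom**, given
the two-point law and compactness (the refuter's `crux_iff_orbitPrecompact_and_unique` with its tightness half
discharged by `orbitPrecompact_of_cpt`). [cite: DuminilCopinICM2022, §8.4 p. 29] -/
theorem existsScaleCovariantLimit_iff_unique_cpt {Δ c : ℝ} (hc : 0 < c)
    (hG : Tendsto (fun y : Site 3 => criticalTwoPoint 3 y * Real.sqrt (∑ i, ((y i : ℝ)) ^ 2) ^ (2 * Δ))
      cofinite (𝓝 c))
    (hcpt : ∀ u : ℕ → ℝ, Tendsto u atTop (𝓝[>] (0 : ℝ)) →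
      ∃ (φ : ℕ → ℕ) (S : CorrFamily 3), StrictMono φ ∧ IsRegular S ∧
        ∀ n, TendstoLocallyUniformlyOn (fun k => rescaledCorrelator (criticalCorr 3) rhoPin n (u (φ k)))
          (S n) atTop (NonCoincident 3 n)) :
    HyperoctahedralRP.ExistsScaleCovariantLimit ↔
      ∀ S S' : CorrFamily 3, IsClusterPoint S → IsClusterPoint S' →
        ∀ n, Set.EqOn (S n) (S' n) (NonCoincident 3 n) := by
  rw [crux_iff_orbitPrecompact_and_unique]
  exact ⟨fun h => h.2, fun h => ⟨orbitPrecompact_of_cpt hc hG hcpt, h⟩⟩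

/-! ### The two branches of the line, parametrised by compactness -/

/-- **Free branch**: if no regular cluster point is interacting, the pinned zoom converges along the full filter
to the Wick power family `W_Δ`, a non-degenerate Möbius covariant limit (`PinnedLimit Δ`). Same proof as the
line's `pinnedLimit_of_allFree`, with compactness as a hypothesis. [cite: AizenmanCDM2020, Prop. 7.2 and remark p. 23] -/
theorem pinnedLimit_of_allFree_cpt {Δ c : ℝ} (hc : 0 < c)
    (hG : Tendsto (fun y : Site 3 => criticalTwoPoint 3 y * Real.sqrt (∑ i, ((y i : ℝ)) ^ 2) ^ (2 * Δ))
      cofinite (𝓝 c))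
    (hcpt : ∀ u : ℕ → ℝ, Tendsto u atTop (𝓝[>] (0 : ℝ)) →
      ∃ (φ : ℕ → ℕ) (S : CorrFamily 3), StrictMono φ ∧ IsRegular S ∧
        ∀ n, TendstoLocallyUniformlyOn (fun k => rescaledCorrelator (criticalCorr 3) rhoPin n (u (φ k)))
          (S n) atTop (NonCoincident 3 n))
    (hfree : ∀ S : CorrFamily 3, IsClusterPoint S → IsRegular S → ¬ HasNontrivialU4 S) :
    ∃ S, PinnedLimit Δ S := by
  have h2 : ∀ S, IsClusterPoint S → ∀ x ∈ NonCoincident 3 2, S 2 x = ‖x 0 - x 1‖ ^ (-(2 * Δ)) :=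
    stub_pinnedTwoPoint Δ c hc hG
  -- every regular cluster point is the Wick power family off the diagonals
  have hW : ∀ S, IsClusterPoint S → IsRegular S →
      ∀ n, ∀ x ∈ NonCoincident 3 n, S n x = wickPower Δ n x := by
    intro S hS hreg
    refine stub_freeClusterPointWick Δ S hS (h2 S hS) fun z hz => ?_
    by_contra hne
    exact hfree S hS hreg ⟨z, hz, hne⟩
  -- a reference cluster point, equal to `wickPower Δ` everywhere
  obtain ⟨φ₀, S₀, hφ₀, hreg₀, hconv₀⟩ := hcpt _ (tendsto_div_succ_nhdsGT one_pos)
  have hS₀ : IsClusterPoint S₀ := isClusterPoint_of_subseq (tendsto_div_succ_nhdsGT one_pos) hφ₀ hconv₀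
  have hS₀W : S₀ = wickPower Δ := by
    funext n x
    by_cases hx : x ∈ NonCoincident 3 n
    · exact hW S₀ hS₀ hreg₀ n x hx
    · rw [hreg₀.1 n x hx, wickPower_of_not_mem hx]
  have hM₀ : IsMoebiusCovariant Δ S₀ := by
    rw [hS₀W]
    exact stub_wickPowerMoebius Δ
  refine ⟨S₀, ?_, isNondegenerateTwoPoint_of_twoPoint (h2 S₀ hS₀), hM₀⟩
  refine hasPointwiseScalingLimit_of_seq_subseq fun n u hu => ?_
  obtain ⟨φ, S, hφ, hreg, hconv⟩ := hcpt u hu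
  have hS : IsClusterPoint S := isClusterPoint_of_subseq hu hφ hconv
  exact ⟨φ, hφ, (hconv n).congr_right fun x hx => by
    rw [hW S hS hreg n x hx, hW S₀ hS₀ hreg₀ n x hx]⟩

/-- **Interacting branch, existence half**: a regular cluster point `S₁` which agrees at even orders `≥ 4`
with every regular cluster point having the same pure-power pair function is the FULL pinned limit (every mesh
sequence has a subsequence along which the zoom converges to a regular cluster point, which is `S₁` off the
diagonals: orders `0`, odd and `2` are free — `⟨1⟩ = 1`, `m*(β_c) = 0`, the common pair law; subsequence
principle). [folklore] -/
theorem hasLimit_of_residue6_cpt {Δ c : ℝ} (hc : 0 < c)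
    (hG : Tendsto (fun y : Site 3 => criticalTwoPoint 3 y * Real.sqrt (∑ i, ((y i : ℝ)) ^ 2) ^ (2 * Δ))
      cofinite (𝓝 c))
    (hcpt : ∀ u : ℕ → ℝ, Tendsto u atTop (𝓝[>] (0 : ℝ)) →
      ∃ (φ : ℕ → ℕ) (S : CorrFamily 3), StrictMono φ ∧ IsRegular S ∧
        ∀ n, TendstoLocallyUniformlyOn (fun k => rescaledCorrelator (criticalCorr 3) rhoPin n (u (φ k)))
          (S n) atTop (NonCoincident 3 n))
    {S₁ : CorrFamily 3} (hS₁ : IsClusterPoint S₁)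
    (h6 : ∀ S₂ : CorrFamily 3, IsClusterPoint S₂ → IsRegular S₂ →
      (∀ x ∈ NonCoincident 3 2, S₂ 2 x = ‖x 0 - x 1‖ ^ (-(2 * Δ))) →
      ∀ m : ℕ, 2 ≤ m → (NonCoincident 3 (2 * m)).EqOn (S₁ (2 * m)) (S₂ (2 * m))) :
    HasPointwiseScalingLimit (criticalCorr 3) rhoPin S₁ := by
  have h2 : ∀ S, IsClusterPoint S → ∀ x ∈ NonCoincident 3 2, S 2 x = ‖x 0 - x 1‖ ^ (-(2 * Δ)) :=
    stub_pinnedTwoPoint Δ c hc hG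
  -- the value of any cluster point along its own mesh sequence, at a non-coincident configuration where the
  -- lattice correlator is CONSTANT in the mesh (orders `0` and odd): it is that constant
  have hconst : ∀ S : CorrFamily 3, IsClusterPoint S → ∀ (n : ℕ) (v : ℝ),
      (∀ (δ : ℝ) (y : Fin n → Site 3), rhoPin δ ^ n * criticalCorr 3 n y = v) →
      ∀ x ∈ NonCoincident 3 n, S n x = v := by
    intro S hS n v hv x hx
    obtain ⟨w, -, hconvw⟩ := hS
    have h := (hconvw n).tendsto_at hx
    have h1 : Tendsto (fun k => rescaledCorrelator (criticalCorr 3) rhoPin n (w k) x) atTop (𝓝 v) :=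
      tendsto_const_nhds.congr fun k => by rw [rescaledCorrelator_apply, hv]
    exact tendsto_nhds_unique h h1
  -- low orders are free: two cluster points with the same pair function agreeing at even orders `≥ 4` agree
  have key : ∀ S : CorrFamily 3, IsClusterPoint S →
      (∀ x ∈ NonCoincident 3 2, S 2 x = ‖x 0 - x 1‖ ^ (-(2 * Δ))) →
      (∀ m : ℕ, 2 ≤ m → (NonCoincident 3 (2 * m)).EqOn (S₁ (2 * m)) (S (2 * m))) →
      ∀ n, (NonCoincident 3 n).EqOn (S₁ n) (S n) := by
    intro S hS h2S h6S n x hx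
    rcases Nat.even_or_odd n with ⟨m, hm⟩ | hodd
    · obtain rfl : n = 2 * m := by omega
      rcases Nat.lt_or_ge m 2 with hm2 | hm2
      · interval_cases m
        · have h0 : ∀ (δ : ℝ) (y : Fin (2 * 0) → Site 3), rhoPin δ ^ (2 * 0) * criticalCorr 3 (2 * 0) y = 1 :=
            fun δ y => by
              rw [Summit.CriticalPhenomena.Ising3DConformalLimit.Theorems.MoebiusLimitOfTwoPointLaw.Negative.criticalCorr_arity_zero]
              simp
          exact (hconst S₁ hS₁ _ 1 h0 x hx).trans (hconst S hS _ 1 h0 x hx).symm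
        · exact (h2 S₁ hS₁ x hx).trans (h2S x hx).symm
      · exact h6S m hm2 hx
    · have h0 : ∀ (δ : ℝ) (y : Fin n → Site 3), rhoPin δ ^ n * criticalCorr 3 n y = 0 := fun δ y => by
        rw [criticalCorr_eq_zero_of_odd (d := 3) le_rfl hodd, mul_zero]
      exact (hconst S₁ hS₁ n 0 h0 x hx).trans (hconst S hS n 0 h0 x hx).symm
  refine hasPointwiseScalingLimit_of_seq_subseq fun n u hu => ?_
  obtain ⟨φ, S, hφ, hreg, hconv⟩ := hcpt u hu
  have hS : IsClusterPoint S := isClusterPoint_of_subseq hu hφ hconv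
  exact ⟨φ, hφ, (hconv n).congr_right fun x hx => (key S hS (h2 S hS) (h6 S hS hreg (h2 S hS)) n hx).symm⟩

/-- **6′ ⇒ the pinned limit exists** (given the two-point law and compactness): case split on whether some
regular cluster point is interacting (`hasLimit_of_residue6_cpt`) or not (`pinnedLimit_of_allFree_cpt`).
Here 6′ is the registered residue `stub_interactingUnique_ge_four` verbatim. [folklore] -/
theorem exists_pinnedLimit_of_residue6_cpt {Δ c : ℝ} (hc : 0 < c)
    (hG : Tendsto (fun y : Site 3 => criticalTwoPoint 3 y * Real.sqrt (∑ i, ((y i : ℝ)) ^ 2) ^ (2 * Δ))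
      cofinite (𝓝 c))
    (hcpt : ∀ u : ℕ → ℝ, Tendsto u atTop (𝓝[>] (0 : ℝ)) →
      ∃ (φ : ℕ → ℕ) (S : CorrFamily 3), StrictMono φ ∧ IsRegular S ∧
        ∀ n, TendstoLocallyUniformlyOn (fun k => rescaledCorrelator (criticalCorr 3) rhoPin n (u (φ k)))
          (S n) atTop (NonCoincident 3 n))
    (h6 : ∀ (Δ' : ℝ) (S₁ S₂ : CorrFamily 3), IsClusterPoint S₁ → IsClusterPoint S₂ →
      IsRegular S₁ → IsRegular S₂ →
      (∀ x ∈ NonCoincident 3 2, S₁ 2 x = ‖x 0 - x 1‖ ^ (-(2 * Δ'))) →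
      (∀ x ∈ NonCoincident 3 2, S₂ 2 x = ‖x 0 - x 1‖ ^ (-(2 * Δ'))) →
      HasNontrivialU4 S₁ → ∀ m : ℕ, 2 ≤ m → (NonCoincident 3 (2 * m)).EqOn (S₁ (2 * m)) (S₂ (2 * m))) :
    ∃ S : CorrFamily 3, HasPointwiseScalingLimit (criticalCorr 3) rhoPin S := by
  by_cases hint : ∃ S₁ : CorrFamily 3, IsClusterPoint S₁ ∧ IsRegular S₁ ∧ HasNontrivialU4 S₁
  · obtain ⟨S₁, hS₁, hreg₁, hU₁⟩ := hint
    have h2 := stub_pinnedTwoPoint Δ c hc hG S₁ hS₁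
    exact ⟨S₁, hasLimit_of_residue6_cpt hc hG hcpt hS₁ fun S₂ hS₂ hreg₂ h2' =>
      h6 Δ S₁ S₂ hS₁ hS₂ hreg₁ hreg₂ h2 h2' hU₁⟩
  · push Not at hint
    obtain ⟨S, hS⟩ := pinnedLimit_of_allFree_cpt hc hG hcpt hint
    exact ⟨S, hS.1⟩

/-! ### The dictionary: 6′ ⟺ item 1981 -/

/-- **Item stmt-1981 ⇒ 6′, unconditionally** (indeed all cluster points of the pinned zoom coincide off the
diagonals under any non-degenerate full-filter limit: `PinnedClusterPoints.clusterPoint_eq`). [folklore] -/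
theorem residue6_of_existsScaleCovariantLimit (h : HyperoctahedralRP.ExistsScaleCovariantLimit) :
    ∀ (Δ' : ℝ) (S₁ S₂ : CorrFamily 3), IsClusterPoint S₁ → IsClusterPoint S₂ →
      IsRegular S₁ → IsRegular S₂ →
      (∀ x ∈ NonCoincident 3 2, S₁ 2 x = ‖x 0 - x 1‖ ^ (-(2 * Δ'))) →
      (∀ x ∈ NonCoincident 3 2, S₂ 2 x = ‖x 0 - x 1‖ ^ (-(2 * Δ'))) →
      HasNontrivialU4 S₁ → ∀ m : ℕ, 2 ≤ m → (NonCoincident 3 (2 * m)).EqOn (S₁ (2 * m)) (S₂ (2 * m)) := by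
  obtain ⟨ρ, Δ, S', hρ, -, hlim, -, hnd, -, -⟩ := h
  intro Δ' S₁ S₂ hS₁ hS₂ _ _ _ _ _ m _ x hx
  rw [clusterPoint_eq hρ hlim hnd hS₁ hx, clusterPoint_eq hρ hlim hnd hS₂ hx]

/-- **Registered anchor `existsScaleCovariantLimit_iff_residue6_cpt` — item stmt-1981
`ExistsScaleCovariantLimit` ⟺ the line's residue 6′ `stub_interactingUnique_ge_four` VERBATIM**, given the
two-point law and compactness of the pinned zoom: the uniqueness residue of the line IS the existence crux
of the summit. [cite: DuminilCopinICM2022, §8.4 p. 29] -/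
theorem existsScaleCovariantLimit_iff_residue6_cpt :
    ∀ (Δ c : ℝ), 0 < c → Tendsto (fun y : Site 3 => criticalTwoPoint 3 y * Real.sqrt (∑ i, ((y i : ℝ)) ^ 2) ^ (2 * Δ)) cofinite (𝓝 c) → (∀ u : ℕ → ℝ, Tendsto u atTop (𝓝[>] (0 : ℝ)) → ∃ (φ : ℕ → ℕ) (S : CorrFamily 3), StrictMono φ ∧ IsRegular S ∧ ∀ n, TendstoLocallyUniformlyOn (fun k => rescaledCorrelator (criticalCorr 3) rhoPin n (u (φ k))) (S n) atTop (NonCoincident 3 n)) → (Summit.CriticalPhenomena.Ising3DConformalLimit.Theses.HyperoctahedralRP.ExistsScaleCovariantLimit ↔ ∀ (Δ' : ℝ) (S₁ S₂ : CorrFamily 3), IsClusterPoint S₁ → IsClusterPoint S₂ → IsRegular S₁ → IsRegular S₂ → (∀ x ∈ NonCoincident 3 2, S₁ 2 x = ‖x 0 - x 1‖ ^ (-(2 * Δ'))) → (∀ x ∈ NonCoincident 3 2, S₂ 2 x = ‖x 0 - x 1‖ ^ (-(2 * Δ'))) → HasNontrivialU4 S₁ → ∀ m : ℕ, 2 ≤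 m → (NonCoincident 3 (2 * m)).EqOn (S₁ (2 * m)) (S₂ (2 * m))) := by
  intro Δ c hc hG hcpt
  refine ⟨residue6_of_existsScaleCovariantLimit, fun h6 => ?_⟩
  obtain ⟨S, hS⟩ := exists_pinnedLimit_of_residue6_cpt hc hG hcpt h6
  exact crux_of_pinnedLimit hS

/-- **6′ ⇒ item 1981**, the useful direction as a one-liner. [folklore] -/
theorem existsScaleCovariantLimit_of_residue6_cpt {Δ c : ℝ} (hc : 0 < c)
    (hG : Tendsto (fun y : Site 3 => criticalTwoPoint 3 y * Real.sqrt (∑ i, ((y i : ℝ)) ^ 2) ^ (2 * Δ))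
      cofinite (𝓝 c))
    (hcpt : ∀ u : ℕ → ℝ, Tendsto u atTop (𝓝[>] (0 : ℝ)) →
      ∃ (φ : ℕ → ℕ) (S : CorrFamily 3), StrictMono φ ∧ IsRegular S ∧
        ∀ n, TendstoLocallyUniformlyOn (fun k => rescaledCorrelator (criticalCorr 3) rhoPin n (u (φ k)))
          (S n) atTop (NonCoincident 3 n))
    (h6 : ∀ (Δ' : ℝ) (S₁ S₂ : CorrFamily 3), IsClusterPoint S₁ → IsClusterPoint S₂ →
      IsRegular S₁ → IsRegular S₂ →
      (∀ x ∈ NonCoincident 3 2, S₁ 2 x = ‖x 0 - x 1‖ ^ (-(2 * Δ'))) →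
      (∀ x ∈ NonCoincident 3 2, S₂ 2 x = ‖x 0 - x 1‖ ^ (-(2 * Δ'))) →
      HasNontrivialU4 S₁ → ∀ m : ℕ, 2 ≤ m → (NonCoincident 3 (2 * m)).EqOn (S₁ (2 * m)) (S₂ (2 * m))) :
    HyperoctahedralRP.ExistsScaleCovariantLimit :=
  (existsScaleCovariantLimit_iff_residue6_cpt Δ c hc hG hcpt).2 h6

/-! ### The inversion residue 5′ on the realised branch is the covariance upgrade of route `HyperoctahedralRP` -/

open Classical in
/-- A normalised family equals its normalisation. [folklore] -/
theorem normalise_eq_of_isNormalised {S : CorrFamily 3} (hS : IsNormalised S) :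
    (fun n x => if x ∈ NonCoincident 3 n then S n x else 0) = S := by
  funext n x
  by_cases hx : x ∈ NonCoincident 3 n
  · rw [if_pos hx]
  · rw [if_neg hx, hS n x hx]

/-- **Scale covariance of the realised pinned limit, with the exponent of the two-point law**: a regular full
pinned limit whose pair function is `‖x₀ − x₁‖^{-2Δ}` is scale covariant with THAT `Δ` (dilations are free for
non-degenerate limits, `exists_scaleCovariant_normalised`; the exponent is read off at the pairs `(0,e₀)`,
`(0,2e₀)`, `delta_eq_of_clusterPoint`). [folklore] -/
theorem isScaleCovariant_of_pinnedLimit_regular {Δ : ℝ} {S : CorrFamily 3}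
    (hlim : HasPointwiseScalingLimit (criticalCorr 3) rhoPin S) (hreg : IsRegular S)
    (h2 : ∀ x ∈ NonCoincident 3 2, S 2 x = ‖x 0 - x 1‖ ^ (-(2 * Δ))) : IsScaleCovariant Δ S := by
  have hnd : IsNondegenerateTwoPoint S := isNondegenerateTwoPoint_of_twoPoint h2
  obtain ⟨Δ', -, hsc⟩ := exists_scaleCovariant_normalised (S := S) rhoPin_pos hlim hnd
  rw [normalise_eq_of_isNormalised hreg.1] at hsc
  have hS : IsClusterPoint S :=
    ⟨fun k => 1 / ((k : ℝ) + 1), tendsto_div_succ_nhdsGT one_pos, fun n =>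
      OnlyInteractionTightness.tendstoLocallyUniformlyOn_comp_tendsto (hlim n) (tendsto_div_succ_nhdsGT one_pos)⟩
  have hΔ : Δ = Δ' := delta_eq_of_clusterPoint rhoPin_pos hlim hnd hsc hS h2
  rw [hΔ]
  exact hsc

/-- **The residue 5′ `stub_interactingInversion_ge_four` from 6′ and the covariance cruxes of route
`HyperoctahedralRP`**, given the two-point law and compactness: by 6′ an interacting regular cluster point is
the full pinned limit (`hasLimit_of_residue6_cpt`), normalised, non-degenerate, translation invariant and
scale covariant with the right `Δ` (`isScaleCovariant_of_pinnedLimit_regular`); item stmt-1980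
`LimitRotationInvariant` (fed with the tree theorem `HRP2Rigidity_of` = item stmt-1979) makes it `O(3)`
invariant, and item stmt-1982 `InversionUpgradeNormalised` makes it inversion covariant. So 5′ carries no
content beyond the two upgrade cruxes once 6′ (= item 1981) holds. [cite: PolandRychkovVichi2019, §II eq. (2)] -/
theorem residue5_of_upgrades_cpt {Δ c : ℝ} (hc : 0 < c)
    (hG : Tendsto (fun y : Site 3 => criticalTwoPoint 3 y * Real.sqrt (∑ i, ((y i : ℝ)) ^ 2) ^ (2 * Δ))
      cofinite (𝓝 c))
    (hcpt : ∀ u : ℕ → ℝ, Tendsto u atTop (𝓝[>] (0 : ℝ)) →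
      ∃ (φ : ℕ → ℕ) (S : CorrFamily 3), StrictMono φ ∧ IsRegular S ∧
        ∀ n, TendstoLocallyUniformlyOn (fun k => rescaledCorrelator (criticalCorr 3) rhoPin n (u (φ k)))
          (S n) atTop (NonCoincident 3 n))
    (h6 : ∀ (Δ' : ℝ) (S₁ S₂ : CorrFamily 3), IsClusterPoint S₁ → IsClusterPoint S₂ →
      IsRegular S₁ → IsRegular S₂ →
      (∀ x ∈ NonCoincident 3 2, S₁ 2 x = ‖x 0 - x 1‖ ^ (-(2 * Δ'))) →
      (∀ x ∈ NonCoincident 3 2, S₂ 2 x = ‖x 0 - x 1‖ ^ (-(2 * Δ'))) →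
      HasNontrivialU4 S₁ → ∀ m : ℕ, 2 ≤ m → (NonCoincident 3 (2 * m)).EqOn (S₁ (2 * m)) (S₂ (2 * m)))
    (hB : HyperoctahedralRP.LimitRotationInvariant) (hD : HyperoctahedralRP.InversionUpgradeNormalised) :
    ∀ (Δ' : ℝ) (S : CorrFamily 3), IsClusterPoint S → IsRegular S →
      (∀ x ∈ NonCoincident 3 2, S 2 x = ‖x 0 - x 1‖ ^ (-(2 * Δ'))) →
      HasNontrivialU4 S →
      ∀ m : ℕ, 2 ≤ m → ∀ x : Fin (2 * m) → EuclideanSpace ℝ (Fin 3), x ∈ NonCoincident 3 (2 * m) →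
        (∀ i, x i ≠ 0) →
        S (2 * m) (fun i => EuclideanGeometry.inversion 0 1 (x i)) =
          (∏ i, ‖x i‖ ^ (2 * Δ')) * S (2 * m) x := by
  intro Δ' S hS hreg h2' hU m _ x _ hx0
  -- the pair law of every cluster point has the exponent `Δ` of the two-point law; work with `h2 : … Δ`
  have h2 : ∀ x ∈ NonCoincident 3 2, S 2 x = ‖x 0 - x 1‖ ^ (-(2 * Δ)) := stub_pinnedTwoPoint Δ c hc hG S hS
  -- `S` is the full pinned limit
  have hlim : HasPointwiseScalingLimit (criticalCorr 3) rhoPin S :=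
    hasLimit_of_residue6_cpt hc hG hcpt hS fun S₂ hS₂ hreg₂ h2₂ =>
      h6 Δ S S₂ hS hS₂ hreg hreg₂ h2 h2₂ hU
  have hnd : IsNondegenerateTwoPoint S := isNondegenerateTwoPoint_of_twoPoint h2
  have hsc : IsScaleCovariant Δ' S := isScaleCovariant_of_pinnedLimit_regular hlim hreg h2'
  have hrot : IsRotationInvariant S :=
    hB Cruxes.HRP2Rigidity.XRayMellin.HRP2Rigidity_of rhoPin Δ' S rhoPin_pos hlim hreg.1 hnd hreg.2.2 hsc
  have hinv : IsInversionCovariant Δ' S :=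
    hD rhoPin Δ' S rhoPin_pos hlim hreg.1 hnd ⟨hreg.2.2, hrot⟩ hsc
  exact hinv (2 * m) x hx0

end Summit.CriticalPhenomena.Ising3DConformalLimit.MoebiusLimitExistsOnlyInteraction

end
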